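import Summits.CriticalPhenomena.PercolationContinuityZ3.Theorems.PercNonProliferationSubpolynomialBlockingStubEnclosureOfBlockingRatio
import Summits.CriticalPhenomena.PercolationContinuityZ3.Theorems.PercNonProliferationSubpolynomialBlockingStubHarrisShields
import HarnessLib

/-!
# Crux `PercNonProliferation.SubpolynomialBlocking` (stmt-CriticalPhenomena-4446), line `root-trick-wall-patch` — stub `stub_enclosureOfBlockingSubpatch`

Helper file for the lead's skeleton of the line `root-trick-wall-patch` of the crux
`Summit.CriticalPhenomena.PercolationContinuityZ3.Theses.PercNonProliferation.SubpolynomialBlocking`.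
Proves exactly the registered stub signature `stub_enclosureOfBlockingSubpatch`; lands with
`--supports stmt-CriticalPhenomena-4446`.

## The statement (covering version of necessity at aspect ratio `R`: `(u^{(R)}_t)^{j·j} ≤ h r`)

At `p = p_c(ℤ³)` let
`u^{(R)}_t = P(¬ ∃ x ∈ Λ_t, ∃ y ∈ ∂ⁱⁿΛ_{Rt}, x ⟷ y in Λ_{Rt})` be the ratio-`R` blocking probability
(`Λ_k = box 3 k = [-k, k]³`), and let `h r = P((openCrossing (hsBall r) (patch r) (farFace r))ᶜ)` be
the wall-patch enclosure probability, where `patch r = {0} × [0, r)²`,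
`hsBall r = [0, 4r] × [-4r, 5r-1]²` (the order interval `Set.Icc ![0, -4r, -4r] ![4r, 5r-1, 5r-1]` of
`Site 3 = Fin 3 → ℤ`) and `farFace r` is the set of points of `hsBall r` with `x₀ = 4r` or a lateral
coordinate at an extreme value `-4r`, `5r-1`. Then `(u^{(R)}_t)^{j·j} ≤ h r` whenever `R ≥ 2`,
`t ≥ 1`, the `j × j` sub-patches of side `t` cover the patch (`r ≤ j t`) and the ratio-`R` annulus at
scale `t` fits under the far face (`R t ≤ 4 r`).

## The argument

Cells `c = (a, b) : Fin j × Fin j`, corners `v_c = (0, a t, b t)`, `τ_c = zdShiftIso v_c`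
(`τ_c z = z + v_c`), cell events
`E_c = (openCrossing (τ_c '' Λ_{Rt}) (τ_c '' Λ_t) (τ_c '' ∂ⁱⁿΛ_{Rt}))ᶜ` (translated ratio-`R` blocking).
* DETERMINISTIC (`StubEnclosureOfBlockingSubpatch.not_mem_openCrossing_of_forall`): if `ω ⊆ E(ℤ³)`
  lies in every `E_c` then `ω` has no open path inside `hsBall r` from `patch r` to `farFace r`.
  Given such a path from `x ∈ patch r`, put `a = ⌊x₁ / t⌋`, `b = ⌊x₂ / t⌋` (`a, b < j` as
  `x₁, x₂ < r ≤ j t`); then `x ∈ τ_c '' Λ_t ⊆ τ_c '' Λ_{Rt - 1}` and every point of the far face is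
  at sup-distance `≥ 4 r ≥ R t` from `v_c` (`a t, b t ≤ r - 1`), so the first exit of the lattice walk
  (`exists_walk_of_mem_openConnIn`, `exists_prefix_exit_edge`) from `τ_c '' Λ_{Rt-1}` through an edge
  `f ∼ g` produces an open walk inside `τ_c '' Λ_{Rt}` from `x` to `g ∈ τ_c '' ∂ⁱⁿΛ_{Rt}`
  (`StubEnclosureOfBlockingSubpatch.mem_openCrossing_shift`, the first-exit argument of
  `StubEnclosureOfBlockingRatio.not_mem_openCrossing` with a general centre), contradicting `ω ∈ E_c`.
* MEASURE: `DCT16.real_mono_of_forall_subset_edgeSet` gives `P(⋂_c E_c) ≤ h r`; the `E_c` are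
  decreasing (`isUpperSet_openCrossing`, complemented), measurable
  (`measurableSet_openCrossing_of_countable`) and all of probability `u^{(R)}_t` by invariance of `P_p`
  under lattice translations (`StubEnclosureOfBlockingRatio.real_compl_openCrossing_shift_eq`,
  Grimmett 1999 §1.6), so Harris–FKG over the `j · j` cells
  (`prob_pow_le_biInter_of_isLowerSet`, Grimmett 1999 Thm. 2.4;
  `StubEnclosureOfBlockingSubpatch.pow_mul_self_le`) gives `(u^{(R)}_t)^{j·j} ≤ P(⋂_c E_c)`.

No new definitions; all sets are written exactly as in the registered signature.
-/

noncomputable section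

namespace Summit.CriticalPhenomena.PercolationContinuityZ3.Theorems.SubpolynomialBlocking

open MeasureTheory Filter Topology
open Literature.Probability.Percolation Literature.Probability.LatticeModels

namespace StubEnclosureOfBlockingSubpatch

/-- **First exit through a translated cube** (deterministic, lattice configurations). If
`ω ⊆ E(ℤ³)` joins `x` to `y` by an open path (inside any `S`), `x ∈ τ_v '' Λ_m`, `x ∈ τ_v '' Λ_K` and
`y ∉ τ_v '' Λ_K` (`τ_v = zdShiftIso v`), then `ω` crosses the translated annulus: there is an open
path inside `τ_v '' Λ_{K+1}` from `τ_v '' Λ_m` to `τ_v '' ∂ⁱⁿΛ_{K+1}` (the maximal initial segment of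
the open lattice walk inside `τ_v '' Λ_K`, `exists_prefix_exit_edge`, followed by its exit edge
`f ∼ g`: `g - v ∈ Λ_{K+1} ∖ Λ_K`, `DCT16.mem_box_succ_of_adj`, is an inner-boundary vertex,
`DCT16.mem_innerBoundary_box_of_natAbs_eq`). The first-exit argument of
`StubEnclosureOfBlockingRatio.not_mem_openCrossing` with a general centre `v`. -/
theorem mem_openCrossing_shift {K m : ℕ} (v : Site 3) {ω : BondConfig (Site 3)} {S : Set (Site 3)}
    {x y : Site 3} (hω : ω ⊆ (zdGraph 3).edgeSet) (hxy : ω ∈ openConnIn S x y)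
    (hxm : x ∈ (zdShiftIso v) '' (↑(box 3 m) : Set (Site 3)))
    (hxS : x ∈ (zdShiftIso v) '' (↑(box 3 K) : Set (Site 3)))
    (hyS : y ∉ (zdShiftIso v) '' (↑(box 3 K) : Set (Site 3))) :
    ω ∈ openCrossing ((zdShiftIso v) '' (↑(box 3 (K + 1)) : Set (Site 3)))
        ((zdShiftIso v) '' (↑(box 3 m) : Set (Site 3)))
        ((zdShiftIso v) '' (↑(innerBoundary (zdGraph 3) (box 3 (K + 1))) : Set (Site 3))) := by
  obtain ⟨P, -, hPω⟩ := exists_walk_of_mem_openConnIn hω hxy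
  -- FIRST EXIT from `τ '' Λ_K` through a lattice edge `f ∼ g` of the walk: `g - v ∈ Λ_{K+1} ∖ Λ_K`.
  obtain ⟨f, g, hfS, hgS, hadj, hfgP, -, P', -, hP'e, hP'S⟩ := exists_prefix_exit_edge _ P hxS hyS
  have hfK : f - v ∈ box 3 K := (StubEnclosureOfBlocking.mem_image_coe_iff _ f _).1 hfS
  have hgK : g - v ∉ box 3 K := fun hg =>
    hgS ((StubEnclosureOfBlocking.mem_image_coe_iff _ g _).2 hg)
  have hgK1 : g - v ∈ box 3 (K + 1) :=
    DCT16.mem_box_succ_of_adj hfK ((StubEnclosureOfBlocking.adj_sub_iff _ f g).2 hadj)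
  refine ⟨x, hxm, g, ?_, mem_openConnIn_of_walk (P'.concat hadj) ?_ ?_⟩
  · -- `g ∈ τ '' ∂ⁱⁿΛ_{K+1}`: a coordinate of `g - v` has absolute value `K + 1`.
    rw [StubEnclosureOfBlocking.mem_image_coe_iff]
    rw [mem_box, not_forall] at hgK
    obtain ⟨i, hi⟩ := hgK
    refine DCT16.mem_innerBoundary_box_of_natAbs_eq hgK1 (i := i) ?_
    have hi' := (mem_box.1 hgK1) i
    push_cast at hi'
    omega
  · -- the walk `P' · (f ∼ g)` stays inside `τ '' Λ_{K+1}`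
    intro z hz
    rw [SimpleGraph.Walk.support_concat, List.mem_append, List.mem_singleton] at hz
    rcases hz with hz | rfl
    · exact (StubEnclosureOfBlocking.mem_image_coe_iff _ z _).2 (box_mono 3 (Nat.le_succ K)
        ((StubEnclosureOfBlocking.mem_image_coe_iff _ z _).1 (hP'S z hz)))
    · exact (StubEnclosureOfBlocking.mem_image_coe_iff _ _ _).2 hgK1
  · -- its edges are edges of the open walk `P`
    intro e he
    rw [SimpleGraph.Walk.edges_concat, List.concat_eq_append, List.mem_append,
      List.mem_singleton] at he
    rcases he with he | rfl
    · exact hPω e (hP'e e he)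
    · exact hPω _ hfgP

/-- **The translated ratio-`R` annuli at the `j × j` sub-patch corners separate the patch from the
far face** (deterministic, lattice configurations). With corners `v_c = (0, a t, b t)`,
`c = (a, b) : Fin j × Fin j`, `τ_c = zdShiftIso v_c`, `r ≤ j t`, `R t ≤ 4 r`, `R ≥ 2`, `t ≥ 1`: if
`ω ⊆ E(ℤ³)` has, for every cell `c`, no open path inside `τ_c '' Λ_{Rt}` from `τ_c '' Λ_t` to
`τ_c '' ∂ⁱⁿΛ_{Rt}`, then `ω` has no open path inside `hsBall r` from `patch r` to `farFace r`: a start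
`x ∈ patch r` lies in the cell `c = (⌊x₁/t⌋, ⌊x₂/t⌋)`, `x ∈ τ_c '' Λ_t ⊆ τ_c '' Λ_{Rt-1}`, and the
far face misses `τ_c '' Λ_{Rt-1}` (`a t, b t ≤ r - 1`, `R t ≤ 4 r`); `mem_openCrossing_shift`. -/
theorem not_mem_openCrossing_of_forall {R j t r : ℕ} {ω : BondConfig (Site 3)} (hR : 2 ≤ R)
    (ht : 1 ≤ t) (hrj : r ≤ j * t) (hRt : R * t ≤ 4 * r) (hω : ω ⊆ (zdGraph 3).edgeSet)
    (h : ∀ c : Fin j × Fin j, ω ∉ openCrossing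
        ((zdShiftIso (![0, ((c.1 : ℕ) : ℤ) * (t : ℤ), ((c.2 : ℕ) : ℤ) * (t : ℤ)] : Site 3)) ''
          (↑(box 3 (R * t)) : Set (Site 3)))
        ((zdShiftIso (![0, ((c.1 : ℕ) : ℤ) * (t : ℤ), ((c.2 : ℕ) : ℤ) * (t : ℤ)] : Site 3)) ''
          (↑(box 3 t) : Set (Site 3)))
        ((zdShiftIso (![0, ((c.1 : ℕ) : ℤ) * (t : ℤ), ((c.2 : ℕ) : ℤ) * (t : ℤ)] : Site 3)) ''
          (↑(innerBoundary (zdGraph 3) (box 3 (R * t))) : Set (Site 3)))) :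
    ω ∉ openCrossing
        (Set.Icc (![0, -(4 * (r : ℤ)), -(4 * (r : ℤ))] : Site 3)
          ![4 * (r : ℤ), 5 * (r : ℤ) - 1, 5 * (r : ℤ) - 1])
        {x : Site 3 | x 0 = 0 ∧ 0 ≤ x 1 ∧ x 1 < (r : ℤ) ∧ 0 ≤ x 2 ∧ x 2 < (r : ℤ)}
        {y : Site 3 | y ∈ Set.Icc (![0, -(4 * (r : ℤ)), -(4 * (r : ℤ))] : Site 3)
            ![4 * (r : ℤ), 5 * (r : ℤ) - 1, 5 * (r : ℤ) - 1] ∧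
          (y 0 = 4 * (r : ℤ) ∨ y 1 = -(4 * (r : ℤ)) ∨ y 1 = 5 * (r : ℤ) - 1 ∨
            y 2 = -(4 * (r : ℤ)) ∨ y 2 = 5 * (r : ℤ) - 1)} := by
  rw [mem_openCrossing_iff]
  rintro ⟨x, ⟨hx0, hx1, hx1', hx2, hx2'⟩, y, ⟨-, hy⟩, hxy⟩
  have ht0 : 0 < t := ht
  have h2t : 2 * t ≤ R * t := Nat.mul_le_mul_right t hR
  obtain ⟨K, hK⟩ : ∃ K, R * t = K + 1 := ⟨R * t - 1, by omega⟩
  -- the cell `(a, b)` of the start `x`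
  have hX1 : (((x 1).toNat : ℕ) : ℤ) = x 1 := Int.toNat_of_nonneg hx1
  have hX2 : (((x 2).toNat : ℕ) : ℤ) = x 2 := Int.toNat_of_nonneg hx2
  have ha1 : (x 1).toNat / t * t ≤ (x 1).toNat := Nat.div_mul_le_self _ _
  have ha2 : (x 1).toNat < (x 1).toNat / t * t + t := Nat.lt_div_mul_add ht0
  have haj : (x 1).toNat / t < j := (Nat.div_lt_iff_lt_mul ht0).2 (lt_of_lt_of_le (by omega) hrj)
  have hb1 : (x 2).toNat / t * t ≤ (x 2).toNat := Nat.div_mul_le_self _ _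
  have hb2 : (x 2).toNat < (x 2).toNat / t * t + t := Nat.lt_div_mul_add ht0
  have hbj : (x 2).toNat / t < j := (Nat.div_lt_iff_lt_mul ht0).2 (lt_of_lt_of_le (by omega) hrj)
  generalize (x 1).toNat / t = a at ha1 ha2 haj
  generalize (x 2).toNat / t = b at hb1 hb2 hbj
  have hA1 : ((a : ℕ) : ℤ) * (t : ℤ) ≤ x 1 := by
    rw [← hX1]
    exact_mod_cast ha1
  have hA2 : x 1 < ((a : ℕ) : ℤ) * (t : ℤ) + t := by
    rw [← hX1]
    exact_mod_cast ha2
  have hB1 : ((b : ℕ) : ℤ) * (t : ℤ) ≤ x 2 := by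
    rw [← hX2]
    exact_mod_cast hb1
  have hB2 : x 2 < ((b : ℕ) : ℤ) * (t : ℤ) + t := by
    rw [← hX2]
    exact_mod_cast hb2
  have hA0 : (0 : ℤ) ≤ ((a : ℕ) : ℤ) * (t : ℤ) := by positivity
  have hB0 : (0 : ℤ) ≤ ((b : ℕ) : ℤ) * (t : ℤ) := by positivity
  have hc : ω ∉ openCrossing
      ((zdShiftIso (![0, ((a : ℕ) : ℤ) * (t : ℤ), ((b : ℕ) : ℤ) * (t : ℤ)] : Site 3)) ''
        (↑(box 3 (K + 1)) : Set (Site 3)))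
      ((zdShiftIso (![0, ((a : ℕ) : ℤ) * (t : ℤ), ((b : ℕ) : ℤ) * (t : ℤ)] : Site 3)) ''
        (↑(box 3 t) : Set (Site 3)))
      ((zdShiftIso (![0, ((a : ℕ) : ℤ) * (t : ℤ), ((b : ℕ) : ℤ) * (t : ℤ)] : Site 3)) ''
        (↑(innerBoundary (zdGraph 3) (box 3 (K + 1))) : Set (Site 3))) := by
    have h' := h (⟨a, haj⟩, ⟨b, hbj⟩)
    rw [hK] at h'
    exact h'
  refine hc (mem_openCrossing_shift _ hω hxy ?_ ?_ ?_)
  · -- `x ∈ τ_c '' Λ_t`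
    rw [StubEnclosureOfBlocking.mem_image_box_iff]
    omega
  · -- `x ∈ τ_c '' Λ_K` (`t ≤ K`)
    rw [StubEnclosureOfBlocking.mem_image_box_iff]
    omega
  · -- `y ∉ τ_c '' Λ_K` (`K < 4 r ≤ ‖y - v_c‖_∞`)
    rw [StubEnclosureOfBlocking.mem_image_box_iff]
    omega

/-- **Harris–FKG over the `j · j` cells.** Decreasing measurable events of common probability `v`,
indexed by `Fin j × Fin j`, satisfy `v ^ (j * j) ≤ P(⋂_c E c)` (Harris–FKG for finitely many
decreasing events, `prob_pow_le_biInter_of_isLowerSet` over `Finset.univ`, whose cardinality is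
`j * j`; the bounded intersection over `univ` is the plain intersection; Grimmett 1999 Thm. 2.4).
The `Fin j × Fin j` version of `StubHarrisShields.pow_hundred_le`. -/
theorem pow_mul_self_le (p : unitInterval) {j : ℕ} {E : Fin j × Fin j → Set (BondConfig (Site 3))}
    {v : ℝ} (hE : ∀ q, (bondPercolation (zdGraph 3) p).real (E q) = v) (hL : ∀ q, IsLowerSet (E q))
    (hM : ∀ q, MeasurableSet (E q)) :
    v ^ (j * j) ≤ (bondPercolation (zdGraph 3) p).real (⋂ q, E q) := by
  have h1 := prob_pow_le_biInter_of_isLowerSet (zdGraph 3) p Finset.univ E (fun q _ => hL q)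
    (fun q _ => hM q) (fun q _ => hE q)
  have h2 : (Finset.univ : Finset (Fin j × Fin j)).card = j * j := by
    rw [Finset.card_univ, Fintype.card_prod, Fintype.card_fin]
  rw [h2] at h1
  simpa only [Finset.mem_univ, Set.iInter_true] using h1

end StubEnclosureOfBlockingSubpatch

/-- **Registered stub `stub_enclosureOfBlockingSubpatch`** (line `root-trick-wall-patch`, crux
`SubpolynomialBlocking`): COVERING VERSION OF NECESSITY AT ASPECT RATIO `R`,
`(u^{(R)}_t)^{j·j} ≤ h r` for `R ≥ 2`, `t ≥ 1`, `r ≤ j t`, `R t ≤ 4 r`, where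
`u^{(R)}_t = P_{p_c}(¬ ∃ x ∈ Λ_t, ∃ y ∈ ∂ⁱⁿΛ_{Rt}, x ⟷ y in Λ_{Rt})` and
`h r = P_{p_c}((openCrossing (hsBall r) (patch r) (farFace r))ᶜ)` is the critical wall-patch enclosure
probability (`patch r = {0} × [0,r)²`, `hsBall r = [0,4r] × [-4r,5r-1]²`, `farFace r` the points of
`hsBall r` at depth `4r` or extreme lateral coordinate). Proof: the `j · j` translates by the
sub-patch corners `v_c = (0, a t, b t)` of the ratio-`R` blocking event are decreasing, measurable and
of probability `u^{(R)}_t` (translation invariance,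
`StubEnclosureOfBlockingRatio.real_compl_openCrossing_shift_eq`), so Harris–FKG
(`StubEnclosureOfBlockingSubpatch.pow_mul_self_le`) bounds the probability of their intersection
below by `(u^{(R)}_t)^{j·j}`; and on lattice configurations the intersection forces the enclosure
event (`StubEnclosureOfBlockingSubpatch.not_mem_openCrossing_of_forall`: the start of a crossing lies
in some cell's `τ_c '' Λ_t` and the far face is outside `τ_c '' Λ_{Rt-1}`; first exit),
`DCT16.real_mono_of_forall_subset_edgeSet`. -/
theorem stub_enclosureOfBlockingSubpatch :
    ∀ R j t r : ℕ, 2 ≤ R → 1 ≤ t → r ≤ j * t → R * t ≤ 4 * r →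
      (bondPercolation (zdGraph 3) (criticalProbI 3)).real
          {ω | ¬ ∃ x ∈ box 3 t, ∃ y ∈ innerBoundary (zdGraph 3) (box 3 (R * t)),
              ω ∈ openConnIn (↑(box 3 (R * t)) : Set (Site 3)) x y} ^ (j * j) ≤
        (bondPercolation (zdGraph 3) (criticalProbI 3)).real
          (openCrossing
            (Set.Icc (![0, -(4 * (r : ℤ)), -(4 * (r : ℤ))] : Site 3)
              ![4 * (r : ℤ), 5 * (r : ℤ) - 1, 5 * (r : ℤ) - 1])
            {x : Site 3 | x 0 = 0 ∧ 0 ≤ x 1 ∧ x 1 < (r : ℤ) ∧ 0 ≤ x 2 ∧ x 2 < (r : ℤ)}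
            {y : Site 3 | y ∈ Set.Icc (![0, -(4 * (r : ℤ)), -(4 * (r : ℤ))] : Site 3)
                ![4 * (r : ℤ), 5 * (r : ℤ) - 1, 5 * (r : ℤ) - 1] ∧
              (y 0 = 4 * (r : ℤ) ∨ y 1 = -(4 * (r : ℤ)) ∨ y 1 = 5 * (r : ℤ) - 1 ∨
                y 2 = -(4 * (r : ℤ)) ∨ y 2 = 5 * (r : ℤ) - 1)})ᶜ := by
  intro R j t r hR ht hrj hRt
  refine le_trans (StubEnclosureOfBlockingSubpatch.pow_mul_self_le (criticalProbI 3)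
    (E := fun c : Fin j × Fin j => (openCrossing
        ((zdShiftIso (![0, ((c.1 : ℕ) : ℤ) * (t : ℤ), ((c.2 : ℕ) : ℤ) * (t : ℤ)] : Site 3)) ''
          (↑(box 3 (R * t)) : Set (Site 3)))
        ((zdShiftIso (![0, ((c.1 : ℕ) : ℤ) * (t : ℤ), ((c.2 : ℕ) : ℤ) * (t : ℤ)] : Site 3)) ''
          (↑(box 3 t) : Set (Site 3)))
        ((zdShiftIso (![0, ((c.1 : ℕ) : ℤ) * (t : ℤ), ((c.2 : ℕ) : ℤ) * (t : ℤ)] : Site 3)) ''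
          (↑(innerBoundary (zdGraph 3) (box 3 (R * t))) : Set (Site 3))))ᶜ)
    (fun c => StubEnclosureOfBlockingRatio.real_compl_openCrossing_shift_eq (criticalProbI 3) _ t
      (R * t))
    (fun c => (isUpperSet_openCrossing _ _ _).compl)
    (fun c => (measurableSet_openCrossing_of_countable _ _ _).compl)) ?_
  exact DCT16.real_mono_of_forall_subset_edgeSet (zdGraph 3) (criticalProbI 3) fun ω hω hA =>
    StubEnclosureOfBlockingSubpatch.not_mem_openCrossing_of_forall hR ht hrj hRt hω fun c =>
      Set.mem_iInter.1 hA c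

end Summit.CriticalPhenomena.PercolationContinuityZ3.Theorems.SubpolynomialBlocking

end
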